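import Summits.AtomisticToContinuum.HydrodynamicLimit.Theorems.RelayRaceLocalityLightConeInLawSVCCountFamilyVariance

/-!
# Count families on `ℕ`: discrete log-concavity envelopes and heavy points near the mean

Helper file (`--supports stmt-AtomisticToContinuum-12500`) of the line `susceptibility-variance-continuity`
of the crux `LightConeInLaw`, for the stub `stub_countLCLT` (part (c): the local central-limit lower bound),
continuing `…SVCCountFamilyMoments` / `…SVCCountFamilyVariance`. Pure discrete analysis.

* `log_ratio_eq`, `log_second_diff_ge`: for a count family `(n+1) p(n+1) = ν g(n) p(n)` with `g ≥ 1/2` and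
  `|g(n+1) - g(n)| ≤ D`, `ν D ≤ 1/8`, the discrete curvature of `log p` is bounded below on `[ν/4, G)`:
  `log p(k+2) - 2 log p(k+1) + log p(k) ≥ -10/ν` (the law is not more concentrated than a Gaussian of
  variance `≍ ν`).
* `concave_up`, `concave_down`: the resulting one-sided Gaussian lower envelopes around a local maximum
  of an arbitrary sequence `ℓ` with curvature `≥ -c`: `ℓ(m ± j) ≥ ℓ(m) - c j(j+1)/2`.
* `tsum_far_le` (Chebyshev), `sum_le_tsum_indicator`, `exists_heavy_near_mean` (pigeonhole): a point
  `n₁` with `|n₁ - M| < w + 1` and `p(n₁) ≥ 3/(4(2w+1))` as soon as the mass at distance `≥ w` from the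
  mean `M` is `≤ 1/4`.
-/

namespace Summit.AtomisticToContinuum.HydrodynamicLimit.Theorems.LightConeInLawSVC.CountLCLT

open scoped BigOperators
open Finset

noncomputable section

variable {p g : ℕ → ℝ} {ν : ℝ}

/-! ### Positivity and the curvature of `log p` -/

/-- **Positivity on the good segment**: `p(n) > 0` for `n ≤ G + 1` if `p(0) > 0` and `g > 0` on `[0, G]`.
[folklore] -/
theorem pos_of_le (hrat : ∀ n, p (n + 1) * ((n : ℝ) + 1) = ν * g n * p n) (hν : 0 < ν) (hp0 : 0 < p 0)
    {G : ℕ} (hg : ∀ n, n ≤ G → 0 < g n) : ∀ n, n ≤ G + 1 → 0 < p n := by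
  intro n
  induction n with
  | zero => intro _; exact hp0
  | succ n ih =>
      intro hn
      have h := hrat n
      have hpn := ih (by omega)
      have hgn := hg n (by omega)
      have hn1 : (0 : ℝ) < (n : ℝ) + 1 := by positivity
      have e : p (n + 1) = ν * g n * p n / ((n : ℝ) + 1) := by
        rw [← h, mul_div_cancel_right₀ _ hn1.ne']
      rw [e]; positivity

/-- **The log-ratio identity**: `log p(k+1) - log p(k) = log ν + log g(k) - log (k+1)`. [folklore] -/
theorem log_ratio_eq (hrat : ∀ n, p (n + 1) * ((n : ℝ) + 1) = ν * g n * p n) (hν : 0 < ν) {k : ℕ}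
    (hpk : 0 < p k) (hpk1 : 0 < p (k + 1)) (hgk : 0 < g k) :
    Real.log (p (k + 1)) - Real.log (p k) = Real.log ν + Real.log (g k) - Real.log ((k : ℝ) + 1) := by
  have h := congrArg Real.log (hrat k)
  have hk1 : (0 : ℝ) < (k : ℝ) + 1 := by positivity
  rw [Real.log_mul hpk1.ne' hk1.ne', Real.log_mul (mul_pos hν hgk).ne' hpk.ne',
    Real.log_mul hν.ne' hgk.ne'] at h
  linarith

/-- `log x ≥ -2 (1 - x)` for `1/2 ≤ x ≤ 1` (from `log x ≥ 1 - 1/x`). [folklore] -/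
theorem neg_two_mul_le_log {x : ℝ} (hx : 1 / 2 ≤ x) (hx1 : x ≤ 1) : -(2 * (1 - x)) ≤ Real.log x := by
  have hx0 : 0 < x := by linarith
  have h := Real.one_sub_inv_le_log_of_pos hx0
  have h2 : -(2 * (1 - x)) ≤ 1 - x⁻¹ := by
    rw [show (1 : ℝ) - x⁻¹ = (x - 1) / x by field_simp, le_div_iff₀ hx0]
    nlinarith
  linarith

/-- **Lower bound on the discrete curvature of `log p`**: for `ν/4 ≤ k + 2`, `k < G`,
`log p(k+2) - 2 log p(k+1) + log p(k) ≥ -10/ν` (`g ≥ 1/2`, `D`-Lipschitz on `[0, G]`, `ν D ≤ 1/8`,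
`ν ≥ 32`). [folklore] -/
theorem log_second_diff_ge (hrat : ∀ n, p (n + 1) * ((n : ℝ) + 1) = ν * g n * p n) (hν32 : 32 ≤ ν)
    {G : ℕ} (hgl : ∀ n, n ≤ G → 1 / 2 ≤ g n) {D : ℝ} (hD : ∀ n, n < G → |g (n + 1) - g n| ≤ D)
    (hνD : ν * D ≤ 1 / 8) (hpos : ∀ n, n ≤ G + 1 → 0 < p n) {k : ℕ} (hkA : ν / 4 ≤ (k : ℝ) + 2)
    (hkG : k < G) :
    -(10 / ν) ≤ Real.log (p (k + 2)) - 2 * Real.log (p (k + 1)) + Real.log (p k) := by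
  have hν : 0 < ν := by linarith
  have hgk : 1 / 2 ≤ g k := hgl k hkG.le
  have hgk1 : 1 / 2 ≤ g (k + 1) := hgl (k + 1) hkG
  have hgk0 : 0 < g k := by linarith
  have hgk10 : 0 < g (k + 1) := by linarith
  have h1 := log_ratio_eq hrat hν (hpos k (by omega)) (hpos (k + 1) (by omega)) hgk0
  have h2 := log_ratio_eq hrat hν (hpos (k + 1) (by omega)) (hpos (k + 2) (by omega)) hgk10
  push_cast at h2
  -- `log g(k+1) - log g(k) ≥ -4D ≥ -1/(2ν)`
  have hD0 : 0 ≤ D := le_trans (abs_nonneg _) (hD k hkG)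
  have h4D : 4 * D ≤ 1 / (2 * ν) := by rw [le_div_iff₀ (by positivity)]; nlinarith
  have hgg : -(1 / (2 * ν)) ≤ Real.log (g (k + 1)) - Real.log (g k) := by
    rcases le_or_gt (g k) (g (k + 1)) with hle | hlt
    · have := Real.log_le_log hgk0 hle
      have : 0 ≤ 1 / (2 * ν) := by positivity
      linarith
    · have hdiff : g k - g (k + 1) ≤ D := by
        have := (abs_le.mp (hD k hkG)).1; linarith
      have hDs : D ≤ 1 / 4 := by nlinarith
      have hx : 1 / 2 ≤ g (k + 1) / g k := by
        rw [le_div_iff₀ hgk0]; nlinarith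
      have hx1 : g (k + 1) / g k ≤ 1 := by rw [div_le_one hgk0]; exact hlt.le
      have h := neg_two_mul_le_log hx hx1
      rw [Real.log_div hgk10.ne' hgk0.ne'] at h
      have h3 : 1 - g (k + 1) / g k ≤ 2 * D := by
        rw [show 1 - g (k + 1) / g k = (g k - g (k + 1)) / g k by field_simp, div_le_iff₀ hgk0]
        nlinarith
      linarith
  -- `log (k+1) - log (k+2) ≥ -1/(k+1) ≥ -8/ν`
  have hkk : -(8 / ν) ≤ Real.log ((k : ℝ) + 1) - Real.log ((k : ℝ) + 1 + 1) := by
    have hk1 : (0 : ℝ) < (k : ℝ) + 1 := by positivity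
    have hx : 1 / 2 ≤ ((k : ℝ) + 1) / ((k : ℝ) + 1 + 1) := by
      rw [le_div_iff₀ (by positivity)]; linarith
    have hx1 : ((k : ℝ) + 1) / ((k : ℝ) + 1 + 1) ≤ 1 := by
      rw [div_le_one (by positivity)]; linarith
    have h := neg_two_mul_le_log hx hx1
    rw [Real.log_div hk1.ne' (by positivity)] at h
    have h3 : 2 * (1 - ((k : ℝ) + 1) / ((k : ℝ) + 1 + 1)) = 2 / ((k : ℝ) + 1 + 1) := by
      field_simp; ring
    rw [h3] at h
    have h4 : 2 / ((k : ℝ) + 1 + 1) ≤ 8 / ν := by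
      rw [div_le_div_iff₀ (by positivity) hν]; linarith
    linarith
  have e : Real.log (p (k + 2)) - 2 * Real.log (p (k + 1)) + Real.log (p k) =
      (Real.log (p (k + 1 + 1)) - Real.log (p (k + 1))) - (Real.log (p (k + 1)) - Real.log (p k)) := by
    ring_nf
  rw [e, h2, h1]
  have h5 : (1 : ℝ) / (2 * ν) + 8 / ν ≤ 10 / ν := by
    rw [div_add_div _ _ (by positivity) hν.ne', div_le_div_iff₀ (by positivity) hν]; nlinarith
  linarith

/-! ### One-sided Gaussian lower envelopes of an almost-concave sequence -/

/-- **Downward envelope.** If `ℓ(k+2) - 2ℓ(k+1) + ℓ(k) ≥ -c` for `A ≤ k < B` and the forward difference at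
`a + j` is `≤ t`, then `ℓ(a + j) - ℓ(a) ≤ j t + c j(j+1)/2` (`A ≤ a`, `a + j ≤ B`). [folklore] -/
theorem concave_down {ℓ : ℕ → ℝ} {A B : ℕ} {c : ℝ}
    (hc : ∀ k, A ≤ k → k < B → -c ≤ ℓ (k + 2) - 2 * ℓ (k + 1) + ℓ k) {a : ℕ} (ha : A ≤ a) :
    ∀ (j : ℕ) (t : ℝ), a + j ≤ B → ℓ (a + j + 1) - ℓ (a + j) ≤ t →
      ℓ (a + j) - ℓ a ≤ j * t + c * ((j : ℝ) * ((j : ℝ) + 1) / 2) := by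
  intro j
  induction j with
  | zero => intro t _ _; simp
  | succ j ih =>
      intro t hjB htop
      have hk := hc (a + j) (by omega) (by omega)
      have hd : ℓ (a + j + 1) - ℓ (a + j) ≤ t + c := by
        have e : a + (j + 1) + 1 = a + j + 2 := by ring
        rw [e, show a + (j + 1) = a + j + 1 by ring] at htop
        linarith
      have h := ih (t + c) (by omega) hd
      rw [show a + (j + 1) = a + j + 1 by ring]
      push_cast
      nlinarith

/-- **Upward envelope.** If `ℓ(k+2) - 2ℓ(k+1) + ℓ(k) ≥ -c` for `A ≤ k < B` and the forward difference at
`b` is `≥ -t`, then `ℓ(b + 1 + j) - ℓ(b + 1) ≥ -(j t + c j(j+1)/2)` (`A ≤ b`, `b + j ≤ B`). [folklore] -/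
theorem concave_up {ℓ : ℕ → ℝ} {A B : ℕ} {c : ℝ}
    (hc : ∀ k, A ≤ k → k < B → -c ≤ ℓ (k + 2) - 2 * ℓ (k + 1) + ℓ k) :
    ∀ (j : ℕ) (b : ℕ) (t : ℝ), A ≤ b → b + j ≤ B → -t ≤ ℓ (b + 1) - ℓ b →
      -(j * t + c * ((j : ℝ) * ((j : ℝ) + 1) / 2)) ≤ ℓ (b + 1 + j) - ℓ (b + 1) := by
  intro j
  induction j with
  | zero => intro b t _ _ _; simp
  | succ j ih =>
      intro b t hb hjB hbot
      have hk := hc b hb (by omega)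
      have hd : -(t + c) ≤ ℓ (b + 1 + 1) - ℓ (b + 1) := by linarith
      have h := ih (b + 1) (t + c) (by omega) (by omega) hd
      rw [show b + 1 + (j + 1) = b + 1 + 1 + j by ring]
      push_cast
      nlinarith

/-! ### Chebyshev and heavy points near the mean -/

/-- **Chebyshev**: the mass at distance `≥ W > 0` from `M = Σ p n` is `≤ V/W²`,
`V = Σ p n² - M²`. [folklore] -/
theorem tsum_far_le (hp : ∀ n, 0 ≤ p n) (hsum : HasSum p 1)
    (hrat : ∀ n, p (n + 1) * ((n : ℝ) + 1) = ν * g n * p n) (hg1 : ∀ n, g n ≤ 1) (hν : 0 < ν)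
    {W : ℝ} (hW : 0 < W) :
    ∑' n, p n * (if W ≤ |(n : ℝ) - ∑' k, p k * (k : ℝ)| then (1 : ℝ) else 0) ≤
      (∑' n, p n * (n : ℝ) ^ 2 - (∑' n, p n * (n : ℝ)) ^ 2) / W ^ 2 := by
  have hV0 := tsum_mul_nat_sub_sq hp hsum hrat hg1 hν (∑' k, p k * (k : ℝ))
  generalize hM : ∑' k, p k * (k : ℝ) = M at hV0 ⊢
  have hV : ∑' n, p n * ((n : ℝ) - M) ^ 2 = ∑' n, p n * (n : ℝ) ^ 2 - M ^ 2 := by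
    rw [hV0]; ring
  have hsq : Summable fun n => p n * ((n : ℝ) - M) ^ 2 :=
    summable_mul_of_le hp hrat hg1 hν (C := (|M| + 1) ^ 2) fun n => by
      have hn0 : (0 : ℝ) ≤ n := Nat.cast_nonneg n
      rw [abs_of_nonneg (sq_nonneg _), ← mul_pow]
      have : |(n : ℝ) - M| ≤ (|M| + 1) * ((n : ℝ) + 1) := by
        calc |(n : ℝ) - M| ≤ |(n : ℝ)| + |M| := abs_sub _ _
          _ = n + |M| := by rw [Nat.abs_cast]
          _ ≤ (|M| + 1) * ((n : ℝ) + 1) := by nlinarith [abs_nonneg M]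
      calc ((n : ℝ) - M) ^ 2 = |(n : ℝ) - M| ^ 2 := (sq_abs _).symm
        _ ≤ ((|M| + 1) * ((n : ℝ) + 1)) ^ 2 := pow_le_pow_left₀ (abs_nonneg _) this 2
  have hsi : Summable fun n => p n * (if W ≤ |(n : ℝ) - M| then (1 : ℝ) else 0) :=
    summable_mul_of_abs_le hp hrat hg1 hν (B := 1) fun n => by split_ifs <;> simp
  have hpt : ∀ n, p n * (if W ≤ |(n : ℝ) - M| then (1 : ℝ) else 0) ≤ (1 / W ^ 2) * (p n * ((n : ℝ) - M) ^ 2) := by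
    intro n
    rw [← mul_assoc, mul_comm (1 / W ^ 2) (p n), mul_assoc]
    refine mul_le_mul_of_nonneg_left ?_ (hp n)
    split_ifs with h
    · rw [one_div, inv_mul_eq_div, le_div_iff₀ (by positivity), one_mul, ← sq_abs ((n : ℝ) - M)]
      exact pow_le_pow_left₀ hW.le h 2
    · positivity
  calc ∑' n, p n * (if W ≤ |(n : ℝ) - M| then (1 : ℝ) else 0)
      ≤ ∑' n, (1 / W ^ 2) * (p n * ((n : ℝ) - M) ^ 2) := hsi.tsum_le_tsum hpt (hsq.mul_left _)
    _ = (1 / W ^ 2) * ∑' n, p n * ((n : ℝ) - M) ^ 2 := tsum_mul_left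
    _ = _ := by rw [hV]; ring

/-- A finite block of weights is dominated by the corresponding indicator series. [folklore] -/
theorem sum_le_tsum_indicator (hp : ∀ n, 0 ≤ p n) (hsum : HasSum p 1) (S : Finset ℕ) {χ : ℕ → ℝ}
    (hχ0 : ∀ n, 0 ≤ χ n) (hχ1 : ∀ n, χ n ≤ 1) (hS : ∀ n ∈ S, χ n = 1) :
    ∑ n ∈ S, p n ≤ ∑' n, p n * χ n := by
  have hs : Summable fun n => p n * χ n := by
    refine Summable.of_nonneg_of_le (fun n => mul_nonneg (hp n) (hχ0 n)) (fun n => ?_) hsum.summable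
    calc p n * χ n ≤ p n * 1 := mul_le_mul_of_nonneg_left (hχ1 n) (hp n)
      _ = p n := mul_one _
  calc ∑ n ∈ S, p n = ∑ n ∈ S, p n * χ n := sum_congr rfl fun n hn => by rw [hS n hn, mul_one]
    _ ≤ ∑' n, p n * χ n := hs.sum_le_tsum S fun n _ => mul_nonneg (hp n) (hχ0 n)

/-- **A heavy point near the mean** (pigeonhole): if the mass at distance `≥ w` from the mean `M` is
`≤ 1/4` (`w ≥ 1` an integer) then some `n₁` with `|n₁ - M| < w + 1` carries `p(n₁) ≥ 3/(4(2w+1))`.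
[folklore] -/
theorem exists_heavy_near_mean (hp : ∀ n, 0 ≤ p n) (hsum : HasSum p 1)
    (hrat : ∀ n, p (n + 1) * ((n : ℝ) + 1) = ν * g n * p n) (hg1 : ∀ n, g n ≤ 1) (hν : 0 < ν)
    {w : ℕ} (hw : 1 ≤ w)
    (hfar : ∑' n, p n * (if (w : ℝ) ≤ |(n : ℝ) - ∑' k, p k * (k : ℝ)| then (1 : ℝ) else 0) ≤ 1 / 4) :
    ∃ n₁ : ℕ, |(n₁ : ℝ) - ∑' k, p k * (k : ℝ)| < w + 1 ∧ 3 / (4 * (2 * (w : ℝ) + 1)) ≤ p n₁ := by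
  set M : ℝ := ∑' k, p k * (k : ℝ) with hM
  have hM0 : 0 ≤ M := tsum_nonneg fun n => mul_nonneg (hp n) (Nat.cast_nonneg n)
  set n₀ : ℕ := ⌊M⌋₊ with hn₀
  have hn₀M : (n₀ : ℝ) ≤ M := Nat.floor_le hM0
  have hMn₀ : M < n₀ + 1 := Nat.lt_floor_add_one M
  set J : Finset ℕ := Ico (n₀ - w) (n₀ + w + 1) with hJ
  have hcard : (J.card : ℝ) ≤ 2 * w + 1 := by
    rw [hJ, Nat.card_Ico]
    have : n₀ + w + 1 - (n₀ - w) ≤ 2 * w + 1 := by omega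
    exact_mod_cast this
  have hJne : J.Nonempty := ⟨n₀, by rw [hJ, mem_Ico]; omega⟩
  have hcard0 : (0 : ℝ) < J.card := by exact_mod_cast hJne.card_pos
  -- the near mass is `≥ 3/4` and sits inside `J`
  set χ : ℕ → ℝ := fun n => if (w : ℝ) ≤ |(n : ℝ) - M| then 1 else 0 with hχ
  have hsχ : Summable fun n => p n * χ n :=
    summable_mul_of_abs_le hp hrat hg1 hν (B := 1) fun n => by simp only [hχ]; split_ifs <;> simp
  have hnear : 3 / 4 ≤ ∑' n, p n * (1 - χ n) := by
    have h1 : ∑' n, p n * (1 - χ n) = ∑' n, p n - ∑' n, p n * χ n := by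
      rw [← hsum.summable.tsum_sub hsχ]; exact tsum_congr fun n => by ring
    rw [h1, hsum.tsum_eq]
    linarith
  have hin : ∀ n, p n * (1 - χ n) ≤ p n * (if n ∈ J then (1 : ℝ) else 0) := by
    intro n
    refine mul_le_mul_of_nonneg_left ?_ (hp n)
    simp only [hχ]
    split_ifs with h1 h2 h2
    · simp
    · simp
    · simp
    · exfalso
      apply h2
      rw [hJ, mem_Ico]
      push Not at h1
      have h3 := abs_lt.mp h1
      constructor
      · by_contra hc
        push Not at hc
        have : (n : ℝ) + w < n₀ := by exact_mod_cast (by omega : n + w < n₀)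
        linarith
      · by_contra hc
        push Not at hc
        have : (n₀ : ℝ) + w + 1 ≤ n := by exact_mod_cast hc
        linarith
  have hsJ : Summable fun n => p n * (if n ∈ J then (1 : ℝ) else 0) :=
    summable_mul_of_abs_le hp hrat hg1 hν (B := 1) fun n => by split_ifs <;> simp
  have hsn : Summable fun n => p n * (1 - χ n) :=
    summable_mul_of_abs_le hp hrat hg1 hν (B := 1) fun n => by
      simp only [hχ]; split_ifs <;> simp
  have hJsum : ∑' n, p n * (if n ∈ J then (1 : ℝ) else 0) = ∑ n ∈ J, p n := by
    rw [tsum_eq_sum (s := J) (fun n hn => by rw [if_neg hn, mul_zero])]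
    exact sum_congr rfl fun n hn => by rw [if_pos hn, mul_one]
  have hJmass : 3 / 4 ≤ ∑ n ∈ J, p n := by
    rw [← hJsum]; exact hnear.trans (hsn.tsum_le_tsum hin hsJ)
  -- pigeonhole
  have hconst : ∑ _n ∈ J, 3 / (4 * (J.card : ℝ)) ≤ ∑ n ∈ J, p n := by
    rw [sum_const, nsmul_eq_mul]
    have : (J.card : ℝ) * (3 / (4 * (J.card : ℝ))) = 3 / 4 := by field_simp
    rw [this]; exact hJmass
  obtain ⟨n₁, hn₁J, hn₁⟩ := exists_le_of_sum_le hJne hconst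
  refine ⟨n₁, ?_, le_trans ?_ hn₁⟩
  · rw [hJ, mem_Ico] at hn₁J
    rw [abs_lt]
    constructor
    · have : (n₀ : ℝ) ≤ n₁ + w := by exact_mod_cast (by omega : n₀ ≤ n₁ + w)
      linarith
    · have : (n₁ : ℝ) + 1 ≤ n₀ + w + 1 := by exact_mod_cast (by omega : n₁ + 1 ≤ n₀ + w + 1)
      linarith
  · rw [div_le_div_iff₀ (by positivity) (by positivity)]
    nlinarith

/-- **COUNT FAMILIES: A HEAVY POINT NEAR THE MEAN** (registered helper `countFamily_heavyPoint` of the line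
`susceptibility-variance-continuity`). For a probability weight `p` on `ℕ` with
`(n+1) p(n+1) = ν g(n) p(n)`, `g ≤ 1`, `ν > 0`: if the mass at distance `≥ w` (`w ≥ 1` an integer) from
the mean is `≤ 1/4`, some `n₁` with `|n₁ - Σ p k k| < w + 1` has `p(n₁) ≥ 3/(4(2w+1))`. [folklore] -/
theorem countFamily_heavyPoint :
    ∀ (p g : ℕ → ℝ) (ν : ℝ) (w : ℕ), (∀ n, 0 ≤ p n) → HasSum p 1 →
      (∀ n, p (n + 1) * ((n : ℝ) + 1) = ν * g n * p n) → (∀ n, g n ≤ 1) → 0 < ν → 1 ≤ w →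
      ∑' n, p n * (if (w : ℝ) ≤ |(n : ℝ) - ∑' k, p k * (k : ℝ)| then (1 : ℝ) else 0) ≤ 1 / 4 →
      ∃ n₁ : ℕ, |(n₁ : ℝ) - ∑' k, p k * (k : ℝ)| < w + 1 ∧ 3 / (4 * (2 * (w : ℝ) + 1)) ≤ p n₁ :=
  fun _ _ _ _ hp hsum hrat hg1 hν hw hfar => exists_heavy_near_mean hp hsum hrat hg1 hν hw hfar

end

end Summit.AtomisticToContinuum.HydrodynamicLimit.Theorems.LightConeInLawSVC.CountLCLT
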